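import Literature.Analysis.FluidPDE.Tao2016AveragedNS.ReachCriticalLine
import HarnessLib

/-!
# The certifiable radius of Tao's gate is an affine function of the forcing, to within 1.35 %

**Honest framing.** low prior, high value-of-information experiment on Tao's machine paradigm; NOT a
claim that NS blows up. This file is Literature-side bookkeeping for the cell `pub-fluidc`: it
reads the two-sided tolerance portrait of [cite: Tao2016AveragedNS, §5.5 Theorem 5.3] in bp3's
typed `ReachCertificate` interface (`ReachCriticalLine.lean`: certified strictly below the line
`ρ + 1.27·(ε_d/c₀²)/√M = 1.2532·u`, impossible on or above `ρ + 1.2535·(ε_d/c₀²)/√M = 1.2535·u`,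
`u = ε²e^{-M}/√M`, `s = ε²e^{-M}`) as a statement about ONE NUMBER per forcing level: the
certifiable input radius. Nothing here is a statement about the Navier–Stokes equations.

**What is new relative to `ReachCertificateSharp.lean` §7 / `ReachHalfPlane.lean` §4.** There
`reachRadius K M ε ε_d` (the supremum of the certified sup-radii `ρ` about (5.6), level one, cycle
time `2`) was bracketed by `1.2532u - 1.27ε_d/√M ≤ reachRadius ≤ 1.2535u`: affine from below, a
CONSTANT from above. With the critical line the upper bound becomes affine too:

* `reachRadius_le_line`: `reachRadius K M ε ε_d ≤ 1.2535·u - 1.2535·ε_d/√M` for `0 ≤ ε_d < s`;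
* `reachRadius_mem_Icc_line`: for `1.27ε_d/√M < 1.2532u`,
  `1.2532u - 1.27ε_d/√M ≤ reachRadius K M ε ε_d ≤ 1.2535u - 1.2535ε_d/√M` — THE CERTIFIABLE RADIUS
  IS THE AFFINE FUNCTION `≈ 1.25·(u - ε_d/√M)` OF THE FORCING, bracketed by two affine functions whose
  values differ by `0.0003u + 0.0165ε_d/√M` (`line_bracket_width`); it vanishes identically from
  `ε_d = s` on (`reachRadius_eq_zero_of_seed_le`, landed);
* `reachRadius_threshold_wide`: the radius is a threshold (every smaller radius certified, no larger
  one) for EVERY `ε_d ≥ 0` — no budget hypothesis (the landed `reachRadius_threshold` asked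
  `2ε_d < 1.2532u`);
* §2 the same at every level `c₀ > 0`: `reachRadiusCone K M ε c₀ ε_d` (cone classes, cycle time
  `2/c₀`) is a threshold, lies in the same bracket in the level-one-equivalent forcing `ε_d/c₀²`
  (`reachRadiusCone_mem_Icc_line`), and vanishes from `ε_d = c₀²s` on
  (`reachRadiusCone_eq_zero_of_sq_mul_seed_le`).

DICTIONARY READING: the relative pre-load a Theorem-5.3 stage tolerates is `1.25·(u - ε_d′/√M)`
where `ε_d′ = ε_d/c₀²` is the forcing heard at level one — pre-load and forcing draw on one budget
at the exchange rate `1.25/√M` (the Gaussian clock mass), at every level of the cascade.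

**What is NOT claimed.** The exact value of the radius inside the bracket; anything for cycle
times other than `2/c₀`; anything fluid-side; anything about Navier–Stokes.
-/

noncomputable section

open Real Set MeasureTheory Metric
open scoped NNReal
open Literature.Analysis.FluidPDE.FluidComputer (ReachCertificate)

namespace Literature.Analysis.FluidPDE.Tao2016AveragedNS

/-! ## §1. Level one: `reachRadius` is affine in the forcing to within `1.35 %` -/

/-- Every NEGATIVE radius is (vacuously) certified: the input class `closedBall delayInit ρ` is
empty. Bookkeeping for the supremum `reachRadius`. [folklore] -/
theorem nonempty_taoReach_of_neg {K M ε εd ρ : ℝ} (hρ : ρ < 0) :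
    Nonempty (ReachCertificate (delayCircuitWith K M ε) (ball (0 : Fin 5 → ℝ) 2) εd 2
      (closedBall delayInit ρ) (firedSet K 6 4)) :=
  ⟨reachCertificateVacuous fun p hp => by rw [closedBall_eq_empty.2 hρ] at hp; exact hp⟩

/-- The certifiable radius is never negative (any member, any forcing level).
[cite: Tao2016AveragedNS, §5.5 Theorem 5.3] -/
theorem reachRadius_nonneg (K M ε εd : ℝ) : 0 ≤ reachRadius K M ε εd := by
  set S : Set ℝ := {ρ : ℝ | Nonempty (ReachCertificate (delayCircuitWith K M ε)
    (ball (0 : Fin 5 → ℝ) 2) εd 2 (closedBall delayInit ρ) (firedSet K 6 4))} with hS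
  change 0 ≤ sSup S
  by_cases hb : BddAbove S
  · by_contra h
    rw [not_le] at h
    obtain ⟨ρ, h1, h2⟩ := exists_between h
    exact absurd (le_csSup hb (show ρ ∈ S from nonempty_taoReach_of_neg h2)) (not_le.2 h1)
  · rw [Real.sSup_of_not_bddAbove hb]

/-- Width of the affine bracket: `(1.2535u - 1.2535v) - (1.2532u - 1.27v) = 0.0003u + 0.0165v`
(`v = ε_d/√M`): at most `0.03 %` of the pre-load scale plus `1.3 %` of the forcing term. [folklore] -/
theorem line_bracket_width (u v : ℝ) :
    (2507 / 2000 * u - 2507 / 2000 * v) - (3133 / 2500 * u - 127 / 100 * v) =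
      3 / 10000 * u + 33 / 2000 * v := by
  ring

section StandingRadius

variable {K M ε : ℝ} (hK : 2 * 20 ^ 42 * (Nat.factorial 42 : ℝ) + 16 ≤ K)
  (hML : 3000 * Real.log K ≤ M) (hMK : M ≤ K ^ 10) (hε : 0 < ε)
  (hεle : ε ≤ exp (-(10 * M)) / K ^ 100)
include hK hML hMK hε hεle

/-- The set of certified radii is bounded above (by the dud level `1.2535u`), for every forcing
level `ε_d ≥ 0`. [cite: Tao2016AveragedNS, §5.5 Theorem 5.3] -/
theorem bddAbove_reachRadii {εd : ℝ} (hεd : 0 ≤ εd) :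
    BddAbove {ρ : ℝ | Nonempty (ReachCertificate (delayCircuitWith K M ε)
      (ball (0 : Fin 5 → ℝ) 2) εd 2 (closedBall delayInit ρ) (firedSet K 6 4))} :=
  ⟨2507 / 2000 * (ε ^ 2 * exp (-M)) / Real.sqrt M, fun ρ hρ => by
    by_contra hlt
    exact (isEmpty_taoReach_of_ge hK hML hMK hε hεle hεd (not_le.1 hlt).le).false hρ.some⟩

/-- **The certifiable radius is a threshold, for EVERY forcing level `ε_d ≥ 0`**: every
`ρ < reachRadius K M ε ε_d` is certified (cycle time `2`), no `ρ > reachRadius K M ε ε_d` is. No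
budget hypothesis (compare `reachRadius_threshold`). [cite: Tao2016AveragedNS, §5.5 Theorem 5.3] -/
theorem reachRadius_threshold_wide {εd : ℝ} (hεd : 0 ≤ εd) :
    (∀ ρ, ρ < reachRadius K M ε εd → Nonempty (ReachCertificate (delayCircuitWith K M ε)
        (ball (0 : Fin 5 → ℝ) 2) εd 2 (closedBall delayInit ρ) (firedSet K 6 4))) ∧
      ∀ ρ, reachRadius K M ε εd < ρ → IsEmpty (ReachCertificate (delayCircuitWith K M ε)
        (ball (0 : Fin 5 → ℝ) 2) εd 2 (closedBall delayInit ρ) (firedSet K 6 4)) := by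
  set S : Set ℝ := {ρ : ℝ | Nonempty (ReachCertificate (delayCircuitWith K M ε)
    (ball (0 : Fin 5 → ℝ) 2) εd 2 (closedBall delayInit ρ) (firedSet K 6 4))} with hS
  have hbdd : BddAbove S := bddAbove_reachRadii hK hML hMK hε hεle hεd
  have hne : S.Nonempty := ⟨-1, nonempty_taoReach_of_neg (by norm_num)⟩
  refine ⟨fun ρ hρ => ?_, fun ρ hρ => ⟨fun C => ?_⟩⟩
  · change ρ < sSup S at hρ
    obtain ⟨ρ', hρ'S, hρρ'⟩ := exists_lt_of_lt_csSup hne hρ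
    exact nonempty_reachCertificate_anti hρρ'.le hρ'S
  · change sSup S < ρ at hρ
    exact absurd (le_csSup hbdd (show ρ ∈ S from ⟨C⟩)) (not_le.2 hρ)

/-- **The certifiable radius lies below the critical line**: for `0 ≤ ε_d < s`,
`reachRadius K M ε ε_d ≤ 1.2535·u - 1.2535·ε_d/√M` (the reduced-seed dud of
`ReachCriticalLine.lean`). [cite: Tao2016AveragedNS, §5.5 Theorem 5.3] -/
theorem reachRadius_le_line {εd : ℝ} (hεd : 0 ≤ εd) (hlt : εd < ε ^ 2 * exp (-M)) :
    reachRadius K M ε εd ≤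
      2507 / 2000 * (ε ^ 2 * exp (-M)) / Real.sqrt M - 2507 / 2000 * εd / Real.sqrt M := by
  set S : Set ℝ := {ρ : ℝ | Nonempty (ReachCertificate (delayCircuitWith K M ε)
    (ball (0 : Fin 5 → ℝ) 2) εd 2 (closedBall delayInit ρ) (firedSet K 6 4))} with hS
  have hne : S.Nonempty := ⟨-1, nonempty_taoReach_of_neg (by norm_num)⟩
  obtain ⟨-, hM4, -⟩ := negKick_params hK hML hMK hε hεle
  have hsq0 : 0 < Real.sqrt M := Real.sqrt_pos.2 (by linarith)
  have hL : 2507 / 2000 * εd / Real.sqrt M < 2507 / 2000 * (ε ^ 2 * exp (-M)) / Real.sqrt M :=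
    div_lt_div_of_pos_right (by linarith) hsq0
  refine csSup_le hne fun ρ hρ => ?_
  by_contra hlt'
  rw [not_le] at hlt'
  have hρ0 : 0 ≤ ρ := by linarith
  exact (isEmpty_taoReach_of_line_le hK hML hMK hε hεle hρ0 hεd (by norm_num : (0 : ℝ) ≤ 2) le_rfl
    (by linarith)).false hρ.some

/-- **THE CERTIFIABLE RADIUS IS AFFINE IN THE FORCING, TO WITHIN `1.35 %`**: for every forcing level
with `1.27·ε_d/√M < 1.2532·u`,
`1.2532·u - 1.27·ε_d/√M ≤ reachRadius K M ε ε_d ≤ 1.2535·u - 1.2535·ε_d/√M` — two affine functions of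
`ε_d` whose values differ by `0.0003u + 0.0165ε_d/√M` (`line_bracket_width`). Lower bound:
`taoReachHalfPlane`; upper bound: the reduced-seed dud. [cite: Tao2016AveragedNS, §5.5 Theorem 5.3] -/
theorem reachRadius_mem_Icc_line {εd : ℝ} (hεd : 0 ≤ εd)
    (hWd : 127 / 100 * εd / Real.sqrt M < 3133 / 2500 * (ε ^ 2 * exp (-M)) / Real.sqrt M) :
    reachRadius K M ε εd ∈
      Icc (3133 / 2500 * (ε ^ 2 * exp (-M)) / Real.sqrt M - 127 / 100 * εd / Real.sqrt M)
        (2507 / 2000 * (ε ^ 2 * exp (-M)) / Real.sqrt M - 2507 / 2000 * εd / Real.sqrt M) := by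
  obtain ⟨-, hM4, -⟩ := negKick_params hK hML hMK hε hεle
  have hsq0 : 0 < Real.sqrt M := Real.sqrt_pos.2 (by linarith)
  have hs : 0 < ε ^ 2 * exp (-M) := by positivity
  have h1 : 127 / 100 * εd < 3133 / 2500 * (ε ^ 2 * exp (-M)) :=
    (div_lt_div_iff_of_pos_right hsq0).1 hWd
  have hlt : εd < ε ^ 2 * exp (-M) := by nlinarith
  exact ⟨(reachRadius_mem_Icc_wide hK hML hMK hε hεle hεd hWd).1,
    reachRadius_le_line hK hML hMK hε hεle hεd hlt⟩

/-- **The radius in closed form up to the bracket**: writing `R(ε_d) := 1.2535·(u - ε_d/√M)` for the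
critical line, `R(ε_d) - (0.0003u + 0.0165ε_d/√M) ≤ reachRadius K M ε ε_d ≤ R(ε_d)` on
`1.27ε_d/√M < 1.2532u`. [cite: Tao2016AveragedNS, §5.5 Theorem 5.3] -/
theorem reachRadius_sub_line_mem {εd : ℝ} (hεd : 0 ≤ εd)
    (hWd : 127 / 100 * εd / Real.sqrt M < 3133 / 2500 * (ε ^ 2 * exp (-M)) / Real.sqrt M) :
    reachRadius K M ε εd -
        (2507 / 2000 * (ε ^ 2 * exp (-M)) / Real.sqrt M - 2507 / 2000 * εd / Real.sqrt M) ∈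
      Icc (-(3 / 10000 * (ε ^ 2 * exp (-M)) / Real.sqrt M + 33 / 2000 * εd / Real.sqrt M)) 0 := by
  obtain ⟨h1, h2⟩ := reachRadius_mem_Icc_line hK hML hMK hε hεle hεd hWd
  constructor
  · have e := line_bracket_width ((ε ^ 2 * exp (-M)) / Real.sqrt M) (εd / Real.sqrt M)
    have e1 : 2507 / 2000 * (ε ^ 2 * exp (-M)) / Real.sqrt M = 2507 / 2000 * ((ε ^ 2 * exp (-M)) / Real.sqrt M) := by ring
    have e2 : 2507 / 2000 * εd / Real.sqrt M = 2507 / 2000 * (εd / Real.sqrt M) := by ring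
    have e3 : 3133 / 2500 * (ε ^ 2 * exp (-M)) / Real.sqrt M = 3133 / 2500 * ((ε ^ 2 * exp (-M)) / Real.sqrt M) := by ring
    have e4 : 127 / 100 * εd / Real.sqrt M = 127 / 100 * (εd / Real.sqrt M) := by ring
    have e5 : 3 / 10000 * (ε ^ 2 * exp (-M)) / Real.sqrt M = 3 / 10000 * ((ε ^ 2 * exp (-M)) / Real.sqrt M) := by ring
    have e6 : 33 / 2000 * εd / Real.sqrt M = 33 / 2000 * (εd / Real.sqrt M) := by ring
    rw [e1, e2, e5, e6]
    rw [e3, e4] at h1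
    linarith
  · linarith

end StandingRadius

/-! ## §2. Every level `c₀ > 0`: the cone radius `reachRadiusCone` -/

/-- **The certifiable radius at level `c₀`**: the supremum of the relative input radii `ρ` for which
the reach interface over the whole phase space, cycle time `2/c₀`, from the cone
`coneFrom c₀ (closedBall delayInit ρ)` into the cone over the fired set is inhabited.
[cite: Tao2016AveragedNS, §5.5 Theorem 5.3, Remark 6.1] -/
def reachRadiusCone (K M ε c₀ εd : ℝ) : ℝ :=
  sSup {ρ : ℝ | Nonempty (ReachCertificate (delayCircuitWith K M ε) (univ : Set (Fin 5 → ℝ)) εd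
    (2 / c₀) (coneFrom c₀ (closedBall delayInit ρ)) (coneFrom c₀ (firedSet K 6 4)))}

/-- Every negative relative radius is (vacuously) certified at every level: the input cone over an
empty ball is empty. [folklore] -/
theorem nonempty_taoReachCone_of_neg {K M ε c₀ εd ρ : ℝ} (hρ : ρ < 0) :
    Nonempty (ReachCertificate (delayCircuitWith K M ε) (univ : Set (Fin 5 → ℝ)) εd (2 / c₀)
      (coneFrom c₀ (closedBall delayInit ρ)) (coneFrom c₀ (firedSet K 6 4))) :=
  ⟨reachCertificateVacuous fun p hp => by
    obtain ⟨c, -, q, hq, -⟩ := hp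
    rw [closedBall_eq_empty.2 hρ] at hq
    exact hq⟩

/-- Certifiability of the cone classes is downward closed in the relative radius
(`ReachCertificate.monoIn`, `coneFrom_mono`). [folklore] -/
theorem nonempty_taoReachCone_anti {K M ε c₀ εd ρ ρ' : ℝ} (h : ρ' ≤ ρ)
    (hne : Nonempty (ReachCertificate (delayCircuitWith K M ε) (univ : Set (Fin 5 → ℝ)) εd (2 / c₀)
      (coneFrom c₀ (closedBall delayInit ρ)) (coneFrom c₀ (firedSet K 6 4)))) :
    Nonempty (ReachCertificate (delayCircuitWith K M ε) (univ : Set (Fin 5 → ℝ)) εd (2 / c₀)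
      (coneFrom c₀ (closedBall delayInit ρ')) (coneFrom c₀ (firedSet K 6 4))) :=
  ⟨hne.some.monoIn (coneFrom_mono (closedBall_subset_closedBall h))⟩

/-- The cone radius is never negative. [cite: Tao2016AveragedNS, §5.5 Theorem 5.3] -/
theorem reachRadiusCone_nonneg (K M ε c₀ εd : ℝ) : 0 ≤ reachRadiusCone K M ε c₀ εd := by
  set S : Set ℝ := {ρ : ℝ | Nonempty (ReachCertificate (delayCircuitWith K M ε)
    (univ : Set (Fin 5 → ℝ)) εd (2 / c₀) (coneFrom c₀ (closedBall delayInit ρ))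
    (coneFrom c₀ (firedSet K 6 4)))} with hS
  change 0 ≤ sSup S
  by_cases hb : BddAbove S
  · by_contra h
    rw [not_le] at h
    obtain ⟨ρ, h1, h2⟩ := exists_between h
    exact absurd (le_csSup hb (show ρ ∈ S from nonempty_taoReachCone_of_neg h2)) (not_le.2 h1)
  · rw [Real.sSup_of_not_bddAbove hb]

/-- **At or beyond the level-`c₀` seed rate the cone radius collapses**: for `ε_d ≥ c₀²·s` (any
member with `K ≥ 2`) exactly the negative radii are certified, so `reachRadiusCone = 0`, and
`ρ = 0` itself is not certified (`isEmpty_taoReachCone_of_seed_le`).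
[cite: Tao2016AveragedNS, §5.5 (5.5)–(5.6), Remark 6.1] -/
theorem reachRadiusCone_eq_zero_of_sq_mul_seed_le {K M ε c₀ εd : ℝ} (hK : 2 ≤ K) (hc₀ : 0 < c₀)
    (hεd : c₀ ^ 2 * (ε ^ 2 * exp (-M)) ≤ εd) : reachRadiusCone K M ε c₀ εd = 0 := by
  have hS : {ρ : ℝ | Nonempty (ReachCertificate (delayCircuitWith K M ε) (univ : Set (Fin 5 → ℝ))
      εd (2 / c₀) (coneFrom c₀ (closedBall delayInit ρ)) (coneFrom c₀ (firedSet K 6 4)))} =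
      Iio 0 := by
    ext ρ
    simp only [mem_setOf_eq, mem_Iio]
    refine ⟨fun h => ?_, fun hρ => nonempty_taoReachCone_of_neg hρ⟩
    by_contra hρ
    exact (isEmpty_taoReachCone_of_seed_le hK hc₀ (not_lt.1 hρ) hεd (by positivity)).false h.some
  rw [reachRadiusCone, hS]
  exact csSup_Iio

section StandingCone

variable {K M ε : ℝ} (hK : 2 * 20 ^ 42 * (Nat.factorial 42 : ℝ) + 16 ≤ K)
  (hML : 3000 * Real.log K ≤ M) (hMK : M ≤ K ^ 10) (hε : 0 < ε)
  (hεle : ε ≤ exp (-(10 * M)) / K ^ 100)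
include hK hML hMK hε hεle

/-- The certified relative radii at level `c₀` are bounded above by the dud level `1.2535u`.
[cite: Tao2016AveragedNS, §5.5 Theorem 5.3, Remark 6.1] -/
theorem bddAbove_reachRadiiCone {c₀ εd : ℝ} (hc₀ : 0 < c₀) (hεd : 0 ≤ εd) :
    BddAbove {ρ : ℝ | Nonempty (ReachCertificate (delayCircuitWith K M ε) (univ : Set (Fin 5 → ℝ))
      εd (2 / c₀) (coneFrom c₀ (closedBall delayInit ρ)) (coneFrom c₀ (firedSet K 6 4)))} :=
  ⟨2507 / 2000 * (ε ^ 2 * exp (-M)) / Real.sqrt M, fun ρ hρ => by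
    by_contra hlt
    exact (isEmpty_taoReachCone_of_ge hK hML hMK hε hεle hc₀ hεd (by positivity) le_rfl
      (not_le.1 hlt).le).false hρ.some⟩

/-- **The cone radius is a threshold, for every level and every forcing level `ε_d ≥ 0`.**
[cite: Tao2016AveragedNS, §5.5 Theorem 5.3, Remark 6.1] -/
theorem reachRadiusCone_threshold {c₀ εd : ℝ} (hc₀ : 0 < c₀) (hεd : 0 ≤ εd) :
    (∀ ρ, ρ < reachRadiusCone K M ε c₀ εd → Nonempty (ReachCertificate (delayCircuitWith K M ε)
        (univ : Set (Fin 5 → ℝ)) εd (2 / c₀) (coneFrom c₀ (closedBall delayInit ρ))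
        (coneFrom c₀ (firedSet K 6 4)))) ∧
      ∀ ρ, reachRadiusCone K M ε c₀ εd < ρ → IsEmpty (ReachCertificate (delayCircuitWith K M ε)
        (univ : Set (Fin 5 → ℝ)) εd (2 / c₀) (coneFrom c₀ (closedBall delayInit ρ))
        (coneFrom c₀ (firedSet K 6 4))) := by
  set S : Set ℝ := {ρ : ℝ | Nonempty (ReachCertificate (delayCircuitWith K M ε)
    (univ : Set (Fin 5 → ℝ)) εd (2 / c₀) (coneFrom c₀ (closedBall delayInit ρ))
    (coneFrom c₀ (firedSet K 6 4)))} with hS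
  have hbdd : BddAbove S := bddAbove_reachRadiiCone hK hML hMK hε hεle hc₀ hεd
  have hne : S.Nonempty := ⟨-1, nonempty_taoReachCone_of_neg (by norm_num)⟩
  refine ⟨fun ρ hρ => ?_, fun ρ hρ => ⟨fun C => ?_⟩⟩
  · change ρ < sSup S at hρ
    obtain ⟨ρ', hρ'S, hρρ'⟩ := exists_lt_of_lt_csSup hne hρ
    exact nonempty_taoReachCone_anti hρρ'.le hρ'S
  · change sSup S < ρ at hρ
    exact absurd (le_csSup hbdd (show ρ ∈ S from ⟨C⟩)) (not_le.2 hρ)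

/-- **The cone radius lies below the critical line**: for `0 ≤ ε_d < c₀²s`,
`reachRadiusCone K M ε c₀ ε_d ≤ 1.2535·u - 1.2535·(ε_d/c₀²)/√M`.
[cite: Tao2016AveragedNS, §5.5 Theorem 5.3, Remark 6.1] -/
theorem reachRadiusCone_le_line {c₀ εd : ℝ} (hc₀ : 0 < c₀) (hεd : 0 ≤ εd)
    (hlt : εd < c₀ ^ 2 * (ε ^ 2 * exp (-M))) :
    reachRadiusCone K M ε c₀ εd ≤
      2507 / 2000 * (ε ^ 2 * exp (-M)) / Real.sqrt M - 2507 / 2000 * (εd / c₀ ^ 2) / Real.sqrt M := by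
  set S : Set ℝ := {ρ : ℝ | Nonempty (ReachCertificate (delayCircuitWith K M ε)
    (univ : Set (Fin 5 → ℝ)) εd (2 / c₀) (coneFrom c₀ (closedBall delayInit ρ))
    (coneFrom c₀ (firedSet K 6 4)))} with hS
  have hne : S.Nonempty := ⟨-1, nonempty_taoReachCone_of_neg (by norm_num)⟩
  obtain ⟨-, hM4, -⟩ := negKick_params hK hML hMK hε hεle
  have hsq0 : 0 < Real.sqrt M := Real.sqrt_pos.2 (by linarith)
  have hc2 : 0 < c₀ ^ 2 := by positivity
  have hlt' : εd / c₀ ^ 2 < ε ^ 2 * exp (-M) := by rw [div_lt_iff₀ hc2]; linarith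
  have hL : 2507 / 2000 * (εd / c₀ ^ 2) / Real.sqrt M <
      2507 / 2000 * (ε ^ 2 * exp (-M)) / Real.sqrt M :=
    div_lt_div_of_pos_right (by linarith) hsq0
  refine csSup_le hne fun ρ hρ => ?_
  by_contra hlt''
  rw [not_le] at hlt''
  have hρ0 : 0 ≤ ρ := by linarith
  exact (isEmpty_taoReachCone_of_line_le hK hML hMK hε hεle hc₀ hρ0 hεd (by positivity) le_rfl
    (by linarith)).false hρ.some

/-- **THE LEVEL-`c₀` RADIUS IS THE SAME AFFINE FUNCTION OF THE LEVEL-ONE-EQUIVALENT FORCING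
`ε_d/c₀²`, TO WITHIN `1.35 %`**: for `1.27·(ε_d/c₀²)/√M < 1.2532·u`,
`1.2532u - 1.27(ε_d/c₀²)/√M ≤ reachRadiusCone K M ε c₀ ε_d ≤ 1.2535u - 1.2535(ε_d/c₀²)/√M`.
Lower bound: `taoReachCone_wide`; upper bound: the rescaled reduced-seed dud.
[cite: Tao2016AveragedNS, §5.5 Theorem 5.3, Remark 6.1] -/
theorem reachRadiusCone_mem_Icc_line {c₀ εd : ℝ} (hc₀ : 0 < c₀) (hεd : 0 ≤ εd)
    (hWd : 127 / 100 * (εd / c₀ ^ 2) / Real.sqrt M < 3133 / 2500 * (ε ^ 2 * exp (-M)) / Real.sqrt M) :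
    reachRadiusCone K M ε c₀ εd ∈
      Icc (3133 / 2500 * (ε ^ 2 * exp (-M)) / Real.sqrt M - 127 / 100 * (εd / c₀ ^ 2) / Real.sqrt M)
        (2507 / 2000 * (ε ^ 2 * exp (-M)) / Real.sqrt M -
          2507 / 2000 * (εd / c₀ ^ 2) / Real.sqrt M) := by
  obtain ⟨-, hM4, -⟩ := negKick_params hK hML hMK hε hεle
  have hsq0 : 0 < Real.sqrt M := Real.sqrt_pos.2 (by linarith)
  have hs : 0 < ε ^ 2 * exp (-M) := by positivity
  have hc2 : 0 < c₀ ^ 2 := by positivity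
  have h1 : 127 / 100 * (εd / c₀ ^ 2) < 3133 / 2500 * (ε ^ 2 * exp (-M)) :=
    (div_lt_div_iff_of_pos_right hsq0).1 hWd
  have hεd' : 0 ≤ εd / c₀ ^ 2 := by positivity
  have hlt' : εd / c₀ ^ 2 < ε ^ 2 * exp (-M) := by nlinarith
  have hlt : εd < c₀ ^ 2 * (ε ^ 2 * exp (-M)) := by
    have := (div_lt_iff₀ hc2).1 hlt'; linarith
  refine ⟨?_, reachRadiusCone_le_line hK hML hMK hε hεle hc₀ hεd hlt⟩
  -- lower bound: every 0 ≤ ρ with ρ + 1.27(εd/c₀²)/√M < 1.2532u is certified (`taoReachCone_wide`)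
  set S : Set ℝ := {ρ : ℝ | Nonempty (ReachCertificate (delayCircuitWith K M ε)
    (univ : Set (Fin 5 → ℝ)) εd (2 / c₀) (coneFrom c₀ (closedBall delayInit ρ))
    (coneFrom c₀ (firedSet K 6 4)))} with hS
  have hbdd : BddAbove S := bddAbove_reachRadiiCone hK hML hMK hε hεle hc₀ hεd
  have hlow : ∀ ρ, 0 ≤ ρ →
      ρ + 127 / 100 * (εd / c₀ ^ 2) / Real.sqrt M < 3133 / 2500 * (ε ^ 2 * exp (-M)) / Real.sqrt M →
        ρ ∈ S :=
    fun ρ hρ hW => ⟨taoReachCone_wide hK hML hMK hε hεle hc₀ hρ hεd hW⟩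
  have h0S : (0 : ℝ) ∈ S := hlow 0 le_rfl (by linarith)
  change _ ≤ sSup S
  by_contra hlt2
  rw [not_le] at hlt2
  have h0le : 0 ≤ sSup S := le_csSup hbdd h0S
  obtain ⟨ρ, hρ1, hρ2⟩ := exists_between hlt2
  have hρS : ρ ∈ S := hlow ρ (h0le.trans hρ1.le) (by linarith)
  exact absurd (le_csSup hbdd hρS) (not_le.2 hρ1)

/-- **The two-sided radius portrait at every level, in one statement**: for `c₀ > 0`, `ε_d ≥ 0`,
(i) below the certified budget the cone radius is affine in `ε_d/c₀²` to within the bracket,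
(ii) from the level-`c₀` seed rate `c₀²s` on it is `0`. The forcing heard at level one is `ε_d/c₀²`
and it trades against relative pre-load at the rate `1.25/√M`, at every level.
[cite: Tao2016AveragedNS, §5.5 Theorem 5.3, Remark 6.1] -/
theorem reachRadiusCone_portrait {c₀ εd : ℝ} (hc₀ : 0 < c₀) (hεd : 0 ≤ εd) :
    (127 / 100 * (εd / c₀ ^ 2) / Real.sqrt M < 3133 / 2500 * (ε ^ 2 * exp (-M)) / Real.sqrt M →
        reachRadiusCone K M ε c₀ εd ∈
          Icc (3133 / 2500 * (ε ^ 2 * exp (-M)) / Real.sqrt M - 127 / 100 * (εd / c₀ ^ 2) / Real.sqrt M)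
            (2507 / 2000 * (ε ^ 2 * exp (-M)) / Real.sqrt M -
              2507 / 2000 * (εd / c₀ ^ 2) / Real.sqrt M)) ∧
      (c₀ ^ 2 * (ε ^ 2 * exp (-M)) ≤ εd → reachRadiusCone K M ε c₀ εd = 0) := by
  have hK2 : (2 : ℝ) ≤ K := by linarith [(negKick_params hK hML hMK hε hεle).1]
  exact ⟨fun hWd => reachRadiusCone_mem_Icc_line hK hML hMK hε hεle hc₀ hεd hWd,
    fun h => reachRadiusCone_eq_zero_of_sq_mul_seed_le hK2 hc₀ h⟩

end StandingCone

end Literature.Analysis.FluidPDE.Tao2016AveragedNS
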